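import Summits.QuantumFields.YangMills.Theorems.LuscherReductionRunningReductionUniformFloor
import HarnessLib

/-!
# The axial-gauge transfer kernel: the zero-flux sector of `K_β` on `(ℤ/L)³` as a kernel on the `2L³+1` non-tree links
# (sub-stub C4a″ of the fixed-lattice programme COARSE(L₀) — route `LuscherReduction`, crux RED stmt-QuantumFields-19978 KT-door 3b′ /
# crux `TwistedTraceScaling` stmt-QuantumFields-20203 S-BASE; design note `pub/ym-fleet/ym-luscher-20007-p1/COARSE-DESIGN.md` §4, §8 brick (vi))

Companion of `…TreeGauge` / `…TreeGaugeHaar` (comb gauge `treeFix`, unit Jacobian `combMix`).  The JOINT comb-gauge law and its consequence, the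
kernel of the gauge-invariant sector written entirely in comb-gauge variables:
* §1 `offMapInv`, `skewInv`, `recon (t, w)` — the configuration with tree links `t` whose comb gauge is `glue w` (tree links `1`, non-tree links `w`);
  `skew ∘ skewInv = id`, ★ `treeFix_recon : treeFix (recon (t, w)) = glue w`, `killTree U = glue (U|off)`;
* §2 ★ `measurePreserving_recon` — `(t, w) ↦ recon (t, w)` carries `Haar^{tree} ⊗ Haar^{off}` to the a-priori measure (the fibres are two-sided Haar
  translations, exactly as for `combMix`); `integral_recon`;
* §3 the **axial kernel** `axialKernel β w w' = ∫ K_β(glue w, recon (t, w')) dt` (integrating the kernel over the tree links of the second slice =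
  over the pointed gauge transformations between the slices: the temporal links of the axial gauge), `0 ≤ axialKernel ≤ e^{2β|E|}`;
* §4 ★★ `transferPotential_eq_axial`: for gauge-invariant bounded measurable `G` and every `W`,
  `∫ K_β(W, V) G(V) dV = ∫ (∫ K_β(W, recon(t,w')) dt) · G(glue w') dw'`, in particular at `W = glue w` the potential is `∫ axialKernel β w w' G(glue w') dw'`;
  ★★ `l2_eq_axial`: `‖G‖² = ∫ G(glue w)² dw`.
So the gauge-invariant (in particular the zero-flux) spectral problem of `K_β` is the spectral problem of `axialKernel β` on `L²(SU(2)^{off})` for functions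
`g = G ∘ glue` — the starting point of the Born–Oppenheimer analysis of INNER NO-INTRUDER `I₁(L)` (`…CoarseUpperCopies`) and of weighted Schur tests for
VALLEY GAIN `V(L)`.  HONEST FRAMING: measure-theoretic bookkeeping on a fixed lattice; femto rung R2b1; not infinite volume, not a gap, not Clay.
-/

set_option autoImplicit false

noncomputable section

open MeasureTheory Filter Topology Real
open scoped Matrix ComplexConjugate BigOperators
open Literature.MathematicalPhysics.QuantumFieldTheory
open Literature.MathematicalPhysics.QuantumLattice

namespace Summit.QuantumFields.YangMills.Theorems.FemtoTransferGap

variable {L : ℕ} [NeZero L]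

/-! ## §1 Reconstruction from comb-gauge coordinates -/

/-- **Inverse fibre map**: `w ↦ T(x)⁻¹ · w · T(x+k)` (undoes `offMap`). [folklore] -/
def offMapInv (uT : TreeIdx L → SU2) (w : OffIdx L → SU2) : OffIdx L → SU2 :=
  fun i => (treeGauge (extOne uT) i.1.1)⁻¹ * w i * treeGauge (extOne uT) (i.1.1.shift i.1.2)

omit [NeZero L] in
/-- `offMap ∘ offMapInv = id`. [folklore] -/
theorem offMap_offMapInv (uT : TreeIdx L → SU2) (w : OffIdx L → SU2) : offMap uT (offMapInv uT w) = w := by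
  funext i; unfold offMap offMapInv; group

omit [NeZero L] in
/-- `offMapInv ∘ offMap = id`. [folklore] -/
theorem offMapInv_offMap (uT : TreeIdx L → SU2) (u : OffIdx L → SU2) : offMapInv uT (offMap uT u) = u := by
  funext i; unfold offMap offMapInv; group

/-- **Inverse skew product** `(t, w) ↦ (t, offMapInv t w)`. [folklore] -/
def skewInv (q : (TreeIdx L → SU2) × (OffIdx L → SU2)) : (TreeIdx L → SU2) × (OffIdx L → SU2) := (q.1, offMapInv q.1 q.2)

omit [NeZero L] in
/-- `skew ∘ skewInv = id`. [folklore] -/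
theorem skew_skewInv (q : (TreeIdx L → SU2) × (OffIdx L → SU2)) : skew (skewInv q) = q := by
  unfold skew skewInv; simp only [offMap_offMapInv]

/-- **Glue**: tree links `1`, non-tree links `w`. [folklore] -/
def glue (w : OffIdx L → SU2) : GaugeConfig 3 L SU2 := splitEquiv.symm (fun _ => 1, w)

/-- **Reconstruction**: `recon (t, w)` = the configuration with tree links `t` whose comb gauge is `glue w`. [folklore] -/
def recon (q : (TreeIdx L → SU2) × (OffIdx L → SU2)) : GaugeConfig 3 L SU2 := splitEquiv.symm (skewInv q)

omit [NeZero L] in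
/-- `glue w` on tree edges. [folklore] -/
theorem glue_apply_of_tree (w : OffIdx L → SU2) {e : Edge 3 L} (h : treeEdge e = true) : glue w e = 1 := by
  unfold glue; rw [splitEquiv_symm_apply, dif_pos h]

omit [NeZero L] in
/-- `glue w` off the tree. [folklore] -/
theorem glue_apply_of_not_tree (w : OffIdx L → SU2) {e : Edge 3 L} (h : ¬ treeEdge e = true) : glue w e = w ⟨e, h⟩ := by
  unfold glue; rw [splitEquiv_symm_apply, dif_neg h]

omit [NeZero L] in
/-- `killTree U = glue (U|off)`. [folklore] -/
theorem killTree_eq_glue (U : GaugeConfig 3 L SU2) : killTree U = glue fun i : OffIdx L => U i.1 := by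
  funext e
  by_cases h : treeEdge e = true
  · rw [glue_apply_of_tree _ h]; unfold killTree; rw [h]; rfl
  · rw [glue_apply_of_not_tree _ h, killTree_apply_of_not_tree U h]

omit [NeZero L] in
/-- `recon (t, w)` on tree edges: the tree datum. [folklore] -/
theorem recon_apply_of_tree (q : (TreeIdx L → SU2) × (OffIdx L → SU2)) {e : Edge 3 L} (h : treeEdge e = true) : recon q e = q.1 ⟨e, h⟩ := by
  unfold recon skewInv; rw [splitEquiv_symm_apply, dif_pos h]

omit [NeZero L] in
/-- `recon (t, w)` off the tree: `T(x)⁻¹ · w_e · T(x+k)`. [folklore] -/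
theorem recon_apply_of_not_tree (q : (TreeIdx L → SU2) × (OffIdx L → SU2)) {e : Edge 3 L} (h : ¬ treeEdge e = true) :
    recon q e = (treeGauge (extOne q.1) e.1)⁻¹ * q.2 ⟨e, h⟩ * treeGauge (extOne q.1) (e.1.shift e.2) := by
  unfold recon skewInv; rw [splitEquiv_symm_apply, dif_neg h]; rfl

/-- The comb transporter of `recon (t, w)` is that of the tree datum. [folklore] -/
theorem treeGauge_recon (q : (TreeIdx L → SU2) × (OffIdx L → SU2)) (x : Site 3 L) : treeGauge (recon q) x = treeGauge (extOne q.1) x :=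
  treeGauge_congr (fun e he => by rw [recon_apply_of_tree q he, extOne_apply_of_tree _ he]) x

/-- ★ **The comb gauge of `recon (t, w)` is `glue w`.** [folklore] -/
theorem treeFix_recon (q : (TreeIdx L → SU2) × (OffIdx L → SU2)) : treeFix (recon q) = glue q.2 := by
  funext e
  by_cases h : treeEdge e = true
  · rw [treeFix_eq_one_of_treeEdge _ h, glue_apply_of_tree _ h]
  · rw [glue_apply_of_not_tree _ h]
    show treeGauge (recon q) e.1 * recon q e * (treeGauge (recon q) (e.1.shift e.2))⁻¹ = q.2 ⟨e, h⟩
    rw [treeGauge_recon, treeGauge_recon, recon_apply_of_not_tree q h]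
    group

/-- Hence a gauge-invariant function reads only the second coordinate: `G (recon (t, w)) = G (glue w)`. [folklore] -/
theorem apply_recon_of_gaugeInvariant {α : Type*} {G : GaugeConfig 3 L SU2 → α}
    (hG : ∀ (g : Site 3 L → SU2) (U : GaugeConfig 3 L SU2), G (gaugeTransform g U) = G U) (q : (TreeIdx L → SU2) × (OffIdx L → SU2)) :
    G (recon q) = G (glue q.2) := by
  rw [← treeFix_recon q]; exact (eq_treeFix_of_gaugeInvariant hG (recon q)).symm

/-! ## §2 The joint comb-gauge law -/

/-- The inverse fibre maps are jointly measurable. [folklore] -/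
theorem measurable_offMapInv_uncurry : Measurable (Function.uncurry (offMapInv (L := L))) := by
  haveI : SecondCountableTopology SU2 := secondCountableTopology_su2
  have hA : ∀ x : Site 3 L, Measurable fun q : (TreeIdx L → SU2) × (OffIdx L → SU2) => treeGauge (extOne q.1) x := fun x =>
    (continuous_treeGauge x).measurable.comp (measurable_extOne.comp measurable_fst)
  refine measurable_pi_iff.mpr fun i => ?_
  simp only [Function.uncurry, offMapInv]
  exact ((hA _).inv.mul ((measurable_pi_apply i).comp measurable_snd)).mul (hA _)

/-- Each inverse fibre map preserves product Haar on the non-tree links. [cite: SeilerLNP1982, §2] -/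
theorem map_offMapInv_eq (uT : TreeIdx L → SU2) :
    Measure.map (offMapInv uT) (Measure.pi fun _ : OffIdx L => haarProbability SU2) = Measure.pi fun _ : OffIdx L => haarProbability SU2 :=
  (measurePreserving_pi (fun _ : OffIdx L => haarProbability SU2) (fun _ : OffIdx L => haarProbability SU2)
    (f := fun (i : OffIdx L) (w : SU2) => (treeGauge (extOne uT) i.1.1)⁻¹ * w * treeGauge (extOne uT) (i.1.1.shift i.1.2))
    fun _ => WilsonGauge.measurePreserving_mul_mul _ _).map_eq

/-- The inverse skew product preserves the product of the two product Haar measures. [folklore] -/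
theorem measurePreserving_skewInv : MeasurePreserving (skewInv (L := L))
    ((Measure.pi fun _ : TreeIdx L => haarProbability SU2).prod (Measure.pi fun _ : OffIdx L => haarProbability SU2))
    ((Measure.pi fun _ : TreeIdx L => haarProbability SU2).prod (Measure.pi fun _ : OffIdx L => haarProbability SU2)) :=
  (MeasurePreserving.id _).skew_product measurable_offMapInv_uncurry (ae_of_all _ fun uT => map_offMapInv_eq uT)

/-- ★ **The joint comb-gauge law**: `(t, w) ↦ recon (t, w)` carries `Haar^{tree} ⊗ Haar^{off}` to the a-priori measure. [cite: SeilerLNP1982, §2] -/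
theorem measurePreserving_recon : MeasurePreserving (recon (L := L))
    ((Measure.pi fun _ : TreeIdx L => haarProbability SU2).prod (Measure.pi fun _ : OffIdx L => haarProbability SU2)) (configMeasure SU2 L) := by
  have hΦ : MeasurePreserving (splitEquiv (L := L)) (configMeasure SU2 L)
      ((Measure.pi fun _ : TreeIdx L => haarProbability SU2).prod (Measure.pi fun _ : OffIdx L => haarProbability SU2)) :=
    measurePreserving_piEquivPiSubtypeProd (fun _ : Edge 3 L => haarProbability SU2) (fun e : Edge 3 L => treeEdge e = true)
  exact (hΦ.symm _).comp measurePreserving_skewInv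

/-- `recon` is measurable. [folklore] -/
theorem measurable_recon : Measurable (recon (L := L)) := measurePreserving_recon.measurable

omit [NeZero L] in
/-- `glue` is measurable. [folklore] -/
theorem measurable_glue : Measurable (glue (L := L)) :=
  splitEquiv.symm.measurable.comp (measurable_const.prodMk measurable_id)

/-- ★ **Integration in comb-gauge coordinates**: `∫ F dμ = ∫∫ F(recon(t,w)) dt dw` for measurable real `F`. [cite: SeilerLNP1982, §2] -/
theorem integral_recon {F : GaugeConfig 3 L SU2 → ℝ} (hF : Measurable F) :
    ∫ V, F V ∂configMeasure SU2 L =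
      ∫ q, F (recon q) ∂(Measure.pi fun _ : TreeIdx L => haarProbability SU2).prod (Measure.pi fun _ : OffIdx L => haarProbability SU2) := by
  rw [← measurePreserving_recon.map_eq, integral_map measurable_recon.aemeasurable hF.aestronglyMeasurable]

/-- The splitting into tree / non-tree links preserves measure (tree `measurePreserving_piEquivPiSubtypeProd`). [folklore] -/
theorem measurePreserving_splitEquiv : MeasurePreserving (splitEquiv (L := L)) (configMeasure SU2 L)
    ((Measure.pi fun _ : TreeIdx L => haarProbability SU2).prod (Measure.pi fun _ : OffIdx L => haarProbability SU2)) :=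
  measurePreserving_piEquivPiSubtypeProd (fun _ : Edge 3 L => haarProbability SU2) (fun e : Edge 3 L => treeEdge e = true)

/-- The off-tree marginal of the a-priori measure: `∫ f(U|off) dμ(U) = ∫ f dHaar^{off}`. [folklore] -/
theorem integral_off_marginal {f : (OffIdx L → SU2) → ℝ} (hf : Measurable f) :
    ∫ U, f (fun i : OffIdx L => U i.1) ∂configMeasure SU2 L = ∫ w, f w ∂(Measure.pi fun _ : OffIdx L => haarProbability SU2) := by
  have hΦ := measurePreserving_splitEquiv (L := L)
  have h1 : ∫ U, f (fun i : OffIdx L => U i.1) ∂configMeasure SU2 L =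
      ∫ U, (fun q : (TreeIdx L → SU2) × (OffIdx L → SU2) => f q.2) (splitEquiv U) ∂configMeasure SU2 L :=
    integral_congr_ae (ae_of_all _ fun U => rfl)
  have hm : Measurable (fun q : (TreeIdx L → SU2) × (OffIdx L → SU2) => f q.2) := hf.comp measurable_snd
  rw [h1, ← integral_map hΦ.measurable.aemeasurable hm.aestronglyMeasurable, hΦ.map_eq, integral_fun_snd, probReal_univ, one_smul]

/-! ## §3 The axial kernel -/

/-- **Axial-gauge transfer kernel** on the non-tree links: `axialKernel β w w' = ∫ K_β(glue w, recon (t, w')) dt` — the temporal-gauge kernel integrated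
over the pointed gauge transformations between consecutive slices (= over the tree links of the second slice). [cite: SeilerLNP1982, §3] [cite: Luscher1983, §2] -/
def axialKernel (β : ℝ) (w w' : OffIdx L → SU2) : ℝ :=
  ∫ t, transferKernel su2Rep β (glue w) (recon (t, w')) ∂(Measure.pi fun _ : TreeIdx L => haarProbability SU2)

/-- For fixed `W`, `V ↦ K_β(W, V)` is measurable. [folklore] -/
theorem measurable_transferKernel_left (β : ℝ) (W : GaugeConfig 3 L SU2) : Measurable (transferKernel su2Rep β W) :=
  Measurable.of_uncurry_left (f := transferKernel su2Rep β) (measurable_transferKernel_lat β)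

/-- `0 ≤ axialKernel`. [folklore] -/
theorem axialKernel_nonneg (β : ℝ) (w w' : OffIdx L → SU2) : 0 ≤ axialKernel β w w' :=
  integral_nonneg fun _ => (transferKernel_pos _ _ _ _).le

/-- `axialKernel ≤ e^{2β|E|}` (`β ≥ 0`). [folklore] -/
theorem axialKernel_le {β : ℝ} (hβ : 0 ≤ β) (w w' : OffIdx L → SU2) : axialKernel β w w' ≤ Real.exp (2 * β) ^ Fintype.card (Edge 3 L) := by
  unfold axialKernel
  calc ∫ t, transferKernel su2Rep β (glue w) (recon (t, w')) ∂(Measure.pi fun _ : TreeIdx L => haarProbability SU2)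
      ≤ ∫ _t, Real.exp (2 * β) ^ Fintype.card (Edge 3 L) ∂(Measure.pi fun _ : TreeIdx L => haarProbability SU2) :=
        integral_mono_of_nonneg (ae_of_all _ fun t => (transferKernel_pos _ _ _ _).le) (integrable_const _)
          (ae_of_all _ fun t => (le_abs_self _).trans (abs_transferKernel_le_lat hβ (glue w, recon (t, w'))))
    _ = Real.exp (2 * β) ^ Fintype.card (Edge 3 L) := by rw [integral_const, probReal_univ, one_smul]

/-! ## §4 The potential and the norm in comb-gauge coordinates -/

/-- ★★ **The transfer potential of a gauge-invariant function in comb-gauge coordinates**: for gauge-invariant bounded measurable `G`, every `W` and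
`β ≥ 0`, `∫ K_β(W,V) G(V) dV = ∫ (∫ K_β(W, recon(t,w')) dt) · G(glue w') dw'`. [cite: SeilerLNP1982, §3] -/
theorem transferPotential_eq_axial {β : ℝ} (hβ : 0 ≤ β) {G : GaugeConfig 3 L SU2 → ℝ} (hGm : Measurable G) {C : ℝ} (hGb : ∀ U, |G U| ≤ C)
    (hGg : ∀ (g : Site 3 L → SU2) (U : GaugeConfig 3 L SU2), G (gaugeTransform g U) = G U) (W : GaugeConfig 3 L SU2) :
    ∫ V, transferKernel su2Rep β W V * G V ∂configMeasure SU2 L =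
      ∫ w', (∫ t, transferKernel su2Rep β W (recon (t, w')) ∂(Measure.pi fun _ : TreeIdx L => haarProbability SU2)) * G (glue w')
        ∂(Measure.pi fun _ : OffIdx L => haarProbability SU2) := by
  have hm : Measurable (fun V : GaugeConfig 3 L SU2 => transferKernel su2Rep β W V * G V) := (measurable_transferKernel_left β W).mul hGm
  rw [integral_recon hm]
  have h2 : (fun q : (TreeIdx L → SU2) × (OffIdx L → SU2) => transferKernel su2Rep β W (recon q) * G (recon q)) =
      fun q => transferKernel su2Rep β W (recon q) * G (glue q.2) :=
    funext fun q => by rw [apply_recon_of_gaugeInvariant hGg]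
  have hC0 : 0 ≤ C := (abs_nonneg _).trans (hGb 1)
  have hint : Integrable (fun q : (TreeIdx L → SU2) × (OffIdx L → SU2) => transferKernel su2Rep β W (recon q) * G (glue q.2))
      ((Measure.pi fun _ : TreeIdx L => haarProbability SU2).prod (Measure.pi fun _ : OffIdx L => haarProbability SU2)) := by
    refine Integrable.of_bound ((((measurable_transferKernel_left β W).comp measurable_recon).mul
      (hGm.comp (measurable_glue.comp measurable_snd))).aestronglyMeasurable) (Real.exp (2 * β) ^ Fintype.card (Edge 3 L) * C)
      (ae_of_all _ fun q => ?_)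
    rw [Real.norm_eq_abs, abs_mul]
    exact mul_le_mul (abs_transferKernel_le_lat hβ (W, recon q)) (hGb _) (abs_nonneg _) (by positivity)
  rw [h2, integral_prod_symm _ hint]
  refine integral_congr_ae (ae_of_all _ fun w' => ?_)
  simp only
  rw [integral_mul_const]

/-- ★ At a comb-gauge configuration `W = glue w` the potential is the axial kernel operator applied to `G ∘ glue`. [folklore] -/
theorem transferPotential_glue_eq_axial {β : ℝ} (hβ : 0 ≤ β) {G : GaugeConfig 3 L SU2 → ℝ} (hGm : Measurable G) {C : ℝ} (hGb : ∀ U, |G U| ≤ C)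
    (hGg : ∀ (g : Site 3 L → SU2) (U : GaugeConfig 3 L SU2), G (gaugeTransform g U) = G U) (w : OffIdx L → SU2) :
    ∫ V, transferKernel su2Rep β (glue w) V * G V ∂configMeasure SU2 L =
      ∫ w', axialKernel β w w' * G (glue w') ∂(Measure.pi fun _ : OffIdx L => haarProbability SU2) :=
  transferPotential_eq_axial hβ hGm hGb hGg (glue w)

/-- ★★ **The norm in comb-gauge coordinates**: `‖G‖² = ∫ G(glue w)² dw` for gauge-invariant measurable `G`. [cite: SeilerLNP1982, §2] -/
theorem l2_eq_axial {G : GaugeConfig 3 L SU2 → ℝ} (hGm : Measurable G)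
    (hGg : ∀ (g : Site 3 L → SU2) (U : GaugeConfig 3 L SU2), G (gaugeTransform g U) = G U) :
    l2 G G = ∫ w, G (glue w) * G (glue w) ∂(Measure.pi fun _ : OffIdx L => haarProbability SU2) := by
  unfold l2
  have hm : Measurable (fun U : GaugeConfig 3 L SU2 => G U * G U) := hGm.mul hGm
  rw [integral_eq_integral_killTree_of_gaugeInvariant hm (fun g U => by rw [hGg])]
  simp_rw [killTree_eq_glue]
  have hm2 : Measurable (fun w : OffIdx L → SU2 => G (glue w) * G (glue w)) := (hGm.comp measurable_glue).mul (hGm.comp measurable_glue)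
  exact integral_off_marginal hm2

/-- The transfer potential `Φ_G(U) = ∫ K_β(U,V) G(V) dV` of a bounded measurable `G` is measurable. [folklore] -/
theorem measurable_transferPotential (β : ℝ) {G : GaugeConfig 3 L SU2 → ℝ} (hGm : Measurable G) :
    Measurable fun U : GaugeConfig 3 L SU2 => ∫ V, transferKernel su2Rep β U V * G V ∂configMeasure SU2 L := by
  have h : Measurable fun p : GaugeConfig 3 L SU2 × GaugeConfig 3 L SU2 => transferKernel su2Rep β p.1 p.2 * G p.2 :=
    (measurable_transferKernel_lat β).mul (hGm.comp measurable_snd)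
  exact (h.stronglyMeasurable.integral_prod_right' (ν := configMeasure SU2 L)).measurable

/-- The transfer potential of a gauge-invariant `G` is gauge invariant. [cite: SeilerLNP1982, §3] -/
theorem transferPotential_gaugeTransform (β : ℝ) {G : GaugeConfig 3 L SU2 → ℝ} (hGm : Measurable G)
    (hGg : ∀ (g : Site 3 L → SU2) (U : GaugeConfig 3 L SU2), G (gaugeTransform g U) = G U) (g : Site 3 L → SU2) (U : GaugeConfig 3 L SU2) :
    ∫ V, transferKernel su2Rep β (gaugeTransform g U) V * G V ∂configMeasure SU2 L = ∫ V, transferKernel su2Rep β U V * G V ∂configMeasure SU2 L := by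
  have hm : Measurable (fun V : GaugeConfig 3 L SU2 => transferKernel su2Rep β (gaugeTransform g U) V * G V) :=
    (measurable_transferKernel_left β (gaugeTransform g U)).mul hGm
  rw [← integral_comp_eq_of_measurePreserving (measurePreserving_gaugeTransform_configMeasure g) hm]
  refine integral_congr_ae (ae_of_all _ fun V => ?_)
  simp only [transferKernel_gaugeTransform, hGg]

/-- ★★★ **The transfer form in comb-gauge coordinates**: for gauge-invariant bounded measurable `G` and `β ≥ 0`,
`⟨G, K_β G⟩ = ∫∫ G(glue w) · axialKernel β w w' · G(glue w') dw dw'` — the zero-flux / gauge-invariant spectral problem of `K_β` is the spectral problem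
of the axial kernel on `L²(SU(2)^{off})`. [cite: SeilerLNP1982, §3] [cite: Luscher1983, §2] -/
theorem qform_eq_axial {β : ℝ} (hβ : 0 ≤ β) {G : GaugeConfig 3 L SU2 → ℝ} (hGm : Measurable G) {C : ℝ} (hGb : ∀ U, |G U| ≤ C)
    (hGg : ∀ (g : Site 3 L → SU2) (U : GaugeConfig 3 L SU2), G (gaugeTransform g U) = G U) :
    qform su2Rep β G G = ∫ w, ∫ w', G (glue w) * axialKernel β w w' * G (glue w')
      ∂(Measure.pi fun _ : OffIdx L => haarProbability SU2) ∂(Measure.pi fun _ : OffIdx L => haarProbability SU2) := by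
  have h1 : qform su2Rep β G G = ∫ U, G U * ∫ V, transferKernel su2Rep β U V * G V ∂configMeasure SU2 L ∂configMeasure SU2 L := by
    unfold qform
    refine integral_congr_ae (ae_of_all _ fun U => ?_)
    simp only
    rw [← integral_const_mul]
    refine integral_congr_ae (ae_of_all _ fun V => ?_)
    simp only
    ring
  have hm : Measurable (fun U : GaugeConfig 3 L SU2 => G U * ∫ V, transferKernel su2Rep β U V * G V ∂configMeasure SU2 L) :=
    hGm.mul (measurable_transferPotential β hGm)
  rw [h1, integral_eq_integral_killTree_of_gaugeInvariant hm (fun g U => by rw [hGg, transferPotential_gaugeTransform β hGm hGg])]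
  simp_rw [killTree_eq_glue]
  have hm2 : Measurable (fun w : OffIdx L → SU2 => G (glue w) * ∫ V, transferKernel su2Rep β (glue w) V * G V ∂configMeasure SU2 L) :=
    (hGm.comp measurable_glue).mul ((measurable_transferPotential β hGm).comp measurable_glue)
  rw [integral_off_marginal hm2]
  refine integral_congr_ae (ae_of_all _ fun w => ?_)
  simp only
  rw [transferPotential_glue_eq_axial hβ hGm hGb hGg w, ← integral_const_mul]
  refine integral_congr_ae (ae_of_all _ fun w' => ?_)
  simp only
  ring

end Summit.QuantumFields.YangMills.Theorems.FemtoTransferGap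

end
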